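import Literature.MathematicalPhysics.QuantumFieldTheory.ConformalBootstrap3D.MixedBlockCoefficients
import HarnessLib

/-!
# The one-variable Pochhammer factor `P(a)` of the mixed-block coefficients: `Π_{ab} = P(a) P(b)`

Dolan–Osborn's Pochhammer factor of the `z`-series coefficients of `g^{Δ₁₂,Δ₃₄}_{Δ,ℓ}` at `d = 3`
(`MixedBlockCoefficients.doPochFactor a b Δ ℓ n j = (λ₁+a)_m (λ₁+b)_m (λ₂−½+a)_{n'} (λ₂−½+b)_{n'}`,
eq. (3.11)) is a product `P(a) · P(b)` of ONE function
`P(a) = (λ₁+a)_m (λ₂−½+a)_{n'} = ∏_{i<m} ((Δ+ℓ)/2 + i + a) · ∏_{i<n'} ((Δ−ℓ−1)/2 + i + a)`.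
This file names `P` (`doPochHalf`) and the ratio `ρ(a) = P(a)/P(0)` (`doPochRatio`) and records:

* `doPochFactor_eq_doPochHalf_mul` — `Π_{ab} = P(a) P(b)`; `doPochHalf_zero_ne_zero` where `Π_{00} ≠ 0`;
* `doPochHalf_pos` — `P(a) > 0` as soon as the two leading factors `(Δ+ℓ)/2 + a`, `(Δ−ℓ−1)/2 + a` are
  positive (all later factors are larger);
* `hrCoeffAB_eq_hrCoeff_mul_doPochRatio` — the RANK-ONE STRUCTURE
  `A_{n,j}(a,b) = A_{n,j}(0,0) · ρ(a) · ρ(b)` wherever `Π_{00}(n,j) ≠ 0`, with `ρ(0) = 1`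
  (`doPochRatio_zero`): across the entries of a matrix sum rule whose blocks differ only in
  `(Δ₁₂, Δ₃₄)`, the level-`(n,j)` coefficient matrix is `A_{n,j}(0,0) · (ρ(a_i) ρ(b_k))_{ik}` — a
  congruence of a fixed matrix of term values, which is what makes a TERMWISE positive-semidefiniteness
  test of a `2 × 2` (or larger) sector possible;
* `hrCoeffAB_nonneg_of_doPochHalf` — sign rule: `P(a) P(b) ≥ 0 ⇒ A_{n,j}(a,b) ≥ 0` above the bound.

USE (planning note, O(2) three-scalar scan, sectors `1` / `2⁺`).  Pure algebra on the tree's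
definitions; no numerics.  DECLARATIONS: `doPochHalf`, `doPochRatio` (definitions).

References: Dolan–Osborn, Nucl. Phys. B 678 (2004) 491, §3 eq. (3.11) (`DolanOsborn2004`);
Hogervorst–Rychkov, Phys. Rev. D 87 (2013) 106004, §3 eqs. (3.6)–(3.9) (`HogervorstRychkov2013`).
-/

namespace Literature.MathematicalPhysics.QuantumFieldTheory.ConformalBootstrap3D

open Finset

/-- **`P(a) = (λ₁+a)_m (λ₂−½+a)_{n'}`**, the one-variable half of Dolan–Osborn's Pochhammer factor
(`λ₁ = (Δ+ℓ)/2`, `λ₂−½ = (Δ−ℓ−1)/2`, `m = doIndexM`, `n' = doIndexN`). [cite: DolanOsborn2004, §3 eq. (3.11)] -/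
noncomputable def doPochHalf (a Δ : ℝ) (ℓ n j : ℕ) : ℝ :=
  (∏ i ∈ Finset.range (doIndexM ℓ n j), ((Δ + ℓ) / 2 + i + a)) *
    ∏ i ∈ Finset.range (doIndexN ℓ n j), ((Δ - ℓ - 1) / 2 + i + a)

/-- **`Π_{ab} = P(a) · P(b)`.** [cite: DolanOsborn2004, §3 eq. (3.11)] -/
theorem doPochFactor_eq_doPochHalf_mul (a b Δ : ℝ) (ℓ n j : ℕ) :
    doPochFactor a b Δ ℓ n j = doPochHalf a Δ ℓ n j * doPochHalf b Δ ℓ n j := by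
  unfold doPochFactor doPochHalf
  rw [Finset.prod_mul_distrib, Finset.prod_mul_distrib]
  ring

/-- `Π_{aa} = P(a)²`. [cite: DolanOsborn2004, §3 eq. (3.11)] -/
theorem doPochFactor_self_eq_sq (a Δ : ℝ) (ℓ n j : ℕ) :
    doPochFactor a a Δ ℓ n j = doPochHalf a Δ ℓ n j ^ 2 := by
  rw [doPochFactor_eq_doPochHalf_mul, sq]

/-- `P(0) ≠ 0` wherever `Π_{00} ≠ 0` (in particular strictly above the unitarity bound with `Δ ≠ 1` if
`ℓ = 0`, `doPochFactor_zero_zero_pos`). [cite: DolanOsborn2004, §3 eq. (3.11)] -/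
theorem doPochHalf_zero_ne_zero {Δ : ℝ} {ℓ n j : ℕ} (h : doPochFactor 0 0 Δ ℓ n j ≠ 0) :
    doPochHalf 0 Δ ℓ n j ≠ 0 := by
  intro h0
  apply h
  rw [doPochFactor_eq_doPochHalf_mul, h0, zero_mul]

/-- **`P(a) > 0` from the two leading factors**: if `(Δ+ℓ)/2 + a > 0` and `(Δ−ℓ−1)/2 + a > 0` then every
factor of `P(a)` is positive. [cite: DolanOsborn2004, §3 eq. (3.11)] -/
theorem doPochHalf_pos {a Δ : ℝ} {ℓ : ℕ} (h₁ : 0 < (Δ + ℓ) / 2 + a) (h₂ : 0 < (Δ - ℓ - 1) / 2 + a)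
    (n j : ℕ) : 0 < doPochHalf a Δ ℓ n j := by
  unfold doPochHalf
  refine mul_pos (Finset.prod_pos fun i _ => ?_) (Finset.prod_pos fun i _ => ?_)
  · have hi : (0 : ℝ) ≤ i := Nat.cast_nonneg i
    linarith
  · have hi : (0 : ℝ) ≤ i := Nat.cast_nonneg i
    linarith

/-- **`P(a) < 0` is impossible once the SECOND factor family is positive and the first is too** — the
contrapositive bookkeeping form used by certificates: `P(a) ≤ 0 ⇒` one of the two leading factors is
`≤ 0`. [cite: DolanOsborn2004, §3 eq. (3.11)] -/
theorem leading_nonpos_of_doPochHalf_nonpos {a Δ : ℝ} {ℓ n j : ℕ} (h : doPochHalf a Δ ℓ n j ≤ 0) :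
    (Δ + ℓ) / 2 + a ≤ 0 ∨ (Δ - ℓ - 1) / 2 + a ≤ 0 := by
  rcases le_or_gt ((Δ + ℓ) / 2 + a) 0 with h₁ | h₁
  · exact Or.inl h₁
  rcases le_or_gt ((Δ - ℓ - 1) / 2 + a) 0 with h₂ | h₂
  · exact Or.inr h₂
  exact absurd h (not_le.mpr (doPochHalf_pos h₁ h₂ n j))

/-- **The ratio `ρ(a) = P(a)/P(0)`.** [cite: DolanOsborn2004, §3 eq. (3.11)] -/
noncomputable def doPochRatio (a Δ : ℝ) (ℓ n j : ℕ) : ℝ :=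
  doPochHalf a Δ ℓ n j / doPochHalf 0 Δ ℓ n j

/-- `ρ(0) = 1` where `P(0) ≠ 0`. [cite: DolanOsborn2004, §3 eq. (3.11)] -/
theorem doPochRatio_zero {Δ : ℝ} {ℓ n j : ℕ} (h : doPochHalf 0 Δ ℓ n j ≠ 0) :
    doPochRatio 0 Δ ℓ n j = 1 :=
  div_self h

/-- **Rank-one structure of the coefficients**: `A_{n,j}(a,b) = A_{n,j}(0,0) · ρ(a) · ρ(b)` wherever
`Π_{00}(n,j) ≠ 0` (`A(0,0)` = Hogervorst–Rychkov's `hrCoeff`). [cite: DolanOsborn2004, §3 eq. (3.11)]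
[cite: HogervorstRychkov2013, §3 eqs. (3.6)–(3.9)] -/
theorem hrCoeffAB_eq_hrCoeff_mul_doPochRatio {a b Δ : ℝ} {ℓ n j : ℕ}
    (h : doPochFactor 0 0 Δ ℓ n j ≠ 0) :
    hrCoeffAB a b Δ ℓ n j = hrCoeff Δ ℓ n j * doPochRatio a Δ ℓ n j * doPochRatio b Δ ℓ n j := by
  have h0 := doPochHalf_zero_ne_zero h
  have key := hrCoeffAB_mul_doPochFactor a b Δ ℓ n j
  rw [doPochFactor_eq_doPochHalf_mul, doPochFactor_eq_doPochHalf_mul] at key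
  unfold doPochRatio
  field_simp
  linear_combination key

/-- The rank-one structure for the reflection-positive family: `A_{n,j}(a,a) = A_{n,j}(0,0) · ρ(a)²`.
[cite: DolanOsborn2004, §3 eq. (3.11)] -/
theorem hrCoeffAB_self_eq_hrCoeff_mul_sq {a Δ : ℝ} {ℓ n j : ℕ} (h : doPochFactor 0 0 Δ ℓ n j ≠ 0) :
    hrCoeffAB a a Δ ℓ n j = hrCoeff Δ ℓ n j * doPochRatio a Δ ℓ n j ^ 2 := by
  rw [hrCoeffAB_eq_hrCoeff_mul_doPochRatio h, sq, mul_assoc]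

/-- **Sign rule**: strictly above the unitarity bound (`Δ ≠ 1` if `ℓ = 0`), `P(a) P(b) ≥ 0 ⇒ A_{n,j}(a,b) ≥ 0`.
[cite: DolanOsborn2004, §3 eq. (3.11)] [cite: HogervorstRychkov2013, §3 eqs. (3.6)–(3.9)] -/
theorem hrCoeffAB_nonneg_of_doPochHalf {a b Δ : ℝ} {ℓ : ℕ} (hΔ : unitarityBound3D ℓ < Δ)
    (h1 : ℓ = 0 → Δ ≠ 1) {n j : ℕ} (hab : 0 ≤ doPochHalf a Δ ℓ n j * doPochHalf b Δ ℓ n j) :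
    0 ≤ hrCoeffAB a b Δ ℓ n j := by
  have hP := doPochFactor_zero_zero_pos hΔ h1 n j
  have key := hrCoeffAB_mul_doPochFactor a b Δ ℓ n j
  rw [doPochFactor_eq_doPochHalf_mul a b] at key
  have hprod : 0 ≤ hrCoeffAB a b Δ ℓ n j * doPochFactor 0 0 Δ ℓ n j := by
    rw [key]
    exact mul_nonneg hab (hrCoeff_nonneg hΔ n j)
  exact not_lt.mp fun hneg => absurd hprod (not_le.mpr (mul_neg_of_neg_of_pos hneg hP))

/-- **Sign rule**: strictly above the bound (`Δ ≠ 1` if `ℓ = 0`), `P(a) P(b) ≤ 0 ⇒ A_{n,j}(a,b) ≤ 0`.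
[cite: DolanOsborn2004, §3 eq. (3.11)] [cite: HogervorstRychkov2013, §3 eqs. (3.6)–(3.9)] -/
theorem hrCoeffAB_nonpos_of_doPochHalf {a b Δ : ℝ} {ℓ : ℕ} (hΔ : unitarityBound3D ℓ < Δ)
    (h1 : ℓ = 0 → Δ ≠ 1) {n j : ℕ} (hab : doPochHalf a Δ ℓ n j * doPochHalf b Δ ℓ n j ≤ 0) :
    hrCoeffAB a b Δ ℓ n j ≤ 0 := by
  have hP := doPochFactor_zero_zero_pos hΔ h1 n j
  have key := hrCoeffAB_mul_doPochFactor a b Δ ℓ n j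
  rw [doPochFactor_eq_doPochHalf_mul a b] at key
  have hprod : hrCoeffAB a b Δ ℓ n j * doPochFactor 0 0 Δ ℓ n j ≤ 0 := by
    rw [key]
    exact mul_nonpos_of_nonpos_of_nonneg hab (hrCoeff_nonneg hΔ n j)
  exact not_lt.mp fun hpos => absurd hprod (not_le.mpr (mul_pos hpos hP))

end Literature.MathematicalPhysics.QuantumFieldTheory.ConformalBootstrap3D
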